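import Literature.Topology.FourManifolds.PlanarArch
import Mathlib.Analysis.InnerProductSpace.PiL2
import Mathlib.Analysis.InnerProductSpace.Calculus
import Mathlib.Analysis.SpecialFunctions.Trigonometric.Deriv
import Mathlib.Analysis.SpecialFunctions.Trigonometric.Inverse
import Mathlib.Analysis.Real.Pi.Bounds
import HarnessLib

/-!
# The wild collar flap, I: profiles, the flap map, smoothness and elementary bounds

Topic `Literature/Topology/FourManifolds`. First of three files constructing an explicit **wild
collar flap**: a `C^∞` map `Φ : ℝ² → ℝ × ℝ²`, `(s, y) ↦ (X, w)`, which

* agrees with the flat strip `(s, y) ↦ (y, (3/100 + s, 0))` for `s ≤ 1/200`,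
* is an injective immersion on `(-3/100, 7/100) × (-11/10, 1/10)`,
* has fibre component `w ≠ 0` of norm `≤ 6/100` there, and
* **covers the flat punctured disc** `{3/5} × {0 < ‖w‖ < 1/50}` with its values on
  `(0, 7/100) × (-11/10, 1/10)` — although `w → 0` only as `s → 7/100`, i.e. the punctured disc is
  swept by slices accumulating, from inside the open parameter domain, onto the frontier
  `s = 7/100`.

Composed with the angle-coordinate parametrisation `(X, w) ↦ μ (circlePoint X, p + w)` of a
tubular neighbourhood `μ`, it turns the far collar flap of an honest band attached to the strand
`μ (·, p)` into a flap whose image contains a punctured meridian disc of that strand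
(`WildStrandBand.lean`); this is the counterexample refuting the mis-stated slide lemma
`FramedLink.IsStrictHandleSlide.slideDiffeoAligned` (`KirbyMovesSlideAlignRefutation.lean`): the
tree's `BandData` (`BandSum.lean`) asks the band to be an injective immersion of the *open*
collar square only, which such a self-accumulating flap is.

## The map

With `χ = Real.smoothTransition` and the slice parameter `s` (eras: `A = (0, 1/100]` planar,
`W₁ = (1/100, 2/100]` lift-off, `W₂ = (2/100, s_z]` turn-around of the radius, `C = (s_z, 7/100)`
contraction to the strand), the profiles are

* `Λ s = 1 - (9/10) χ(200 s - 1) - (1/10) χ(100 s - 4)` — length scale of the slice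
  (`1 → 1/10` on `[1/200, 1/100]`, `1/10 → 0` on `[4/100, 5/100]`);
* `ψ s = ψ₀ χ(200 s - 2) + (π/2 - ψ₀) χ(100 s - 3)`, `ψ₀ = arcsin (1/5)` — turning angle of the
  slice from axial to circumferential (`0 → ψ₀` on `[1/100, 3/200]`, `ψ₀ → π/2` on
  `[3/100, 4/100]`);
* `θh s = (1/2) χ(100 s - 2)` — axial drift (`0 → 1/2` on `[2/100, 3/100]`);
* `crad s = 3/100 + s - 2 (s - 2/100) χ(100 s - 2)` — radius of the slice (`3/100 + s` up to
  `s = 2/100`, then a bump, then `7/100 - s` from `s = 3/100` on, vanishing at `s = 7/100`);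
* `σ y = (5/6)(y + 11/10) ∈ (0, 1)`, `υ y = χ(1 + y - y⋆)` with `σ y⋆ = 1/(2π + 1)` — position
  along the slice and the tilt separating the two sheets of a closed-up slice;

and `Φ (s, y) = (axial s y, fibre s y)` with
`axial s y = θh s + Λ s · y + (1/10) sin (ψ s) · υ y`,
`fibre s y = crad s · (cos (ang s y), sin (ang s y))`, `ang s y = sin (ψ s) (2π + 1) σ y`.

This file: the definitions, the values of the profiles on the various eras, smoothness, and the
elementary bounds. `WildCollarFlapDeriv.lean`: derivatives and the immersion property.
`WildCollarFlapInjective.lean`: injectivity and the punctured disc. No named facts.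

## References

* R. C. Kirby, *The Topology of 4-Manifolds*, LNM 1374 (1989), Ch. I §4 (bands are embedded
  closed rectangles — the hypothesis the weak `BandData` drops). [cite: Kirby1989, Ch. I §4]
-/

noncomputable section

open Set Real
open scoped ContDiff

namespace Literature.Topology.FourManifolds

/-- Local notation: `𝔼 n` is the model Euclidean space `EuclideanSpace ℝ (Fin n)`. -/
local notation "𝔼 " n:arg => EuclideanSpace ℝ (Fin n)

namespace WildFlap

/-! ## The profiles -/

/-- Shorthand for Mathlib's smooth transition `χ`. [folklore] -/
local notation "χ" => Real.smoothTransition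

/-- **Length scale** `Λ` of the slices: `1` for `s ≤ 1/200`, `1/10` on `[1/100, 4/100]`, `0` for
`s ≥ 5/100`, non-increasing. [folklore] -/
def Λ (s : ℝ) : ℝ := 1 - 9 / 10 * χ (200 * s - 1) - 1 / 10 * χ (100 * s - 4)

/-- The lift-off angle `ψ₀ = arcsin (1/5)`. [folklore] -/
def ψ₀ : ℝ := Real.arcsin (1 / 5)

/-- **Turning angle** `ψ` of the slices: `0` for `s ≤ 1/100`, `ψ₀` on `[3/200, 3/100]`, `π/2`
for `s ≥ 4/100`, non-decreasing. [folklore] -/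
def ψ (s : ℝ) : ℝ := ψ₀ * χ (200 * s - 2) + (π / 2 - ψ₀) * χ (100 * s - 3)

/-- **Axial drift** `θh`: `0` for `s ≤ 2/100`, `1/2` for `s ≥ 3/100`, strictly increasing in
between. [folklore] -/
def θh (s : ℝ) : ℝ := 1 / 2 * χ (100 * s - 2)

/-- **Radius** `crad` of the slices: `3/100 + s` for `s ≤ 2/100`, `7/100 - s` for `s ≥ 3/100`,
and the bump `5/100 + (s - 2/100)(1 - 2χ(100 s - 2))` in between. [folklore] -/
def crad (s : ℝ) : ℝ := 3 / 100 + s - 2 * (s - 2 / 100) * χ (100 * s - 2)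

/-- **Position along the slice**, rescaled to `(0, 1)` on `y ∈ (-11/10, 1/10)`. [folklore] -/
def σ (y : ℝ) : ℝ := 5 / 6 * (y + 11 / 10)

/-- The tilt threshold `y⋆`, with `σ y⋆ = 1 / (2π + 1)`. [folklore] -/
def ystar : ℝ := -(11 / 10) + 6 / 5 / (2 * π + 1)

/-- **Tilt profile** `υ y = χ (1 + y - y⋆)`: `< 1` for `y < y⋆`, `= 1` for `y ≥ y⋆`,
non-decreasing, positive. [folklore] -/
def υ (y : ℝ) : ℝ := χ (1 + y - ystar)

/-- **Direction angle** of the point `(s, y)` of a slice around the strand. [folklore] -/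
def ang (s y : ℝ) : ℝ := Real.sin (ψ s) * (2 * π + 1) * σ y

/-- **Axial coordinate** of the flap. [folklore] -/
def axial (s y : ℝ) : ℝ := θh s + Λ s * y + 1 / 10 * Real.sin (ψ s) * υ y

/-- The first basis vector `e₀ = (1, 0)` of `ℝ²`. [folklore] -/
def e₀ : 𝔼 2 := EuclideanSpace.single 0 1

/-- The second basis vector `e₁ = (0, 1)` of `ℝ²`. [folklore] -/
def e₁ : 𝔼 2 := EuclideanSpace.single 1 1

/-- The planar vector with coordinates `(a, b)`. [folklore] -/
def vec (a b : ℝ) : 𝔼 2 := a • e₀ + b • e₁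

/-- **Fibre coordinate** of the flap: `crad s · (cos (ang s y), sin (ang s y))`. [folklore] -/
def fibre (s y : ℝ) : 𝔼 2 := vec (crad s * Real.cos (ang s y)) (crad s * Real.sin (ang s y))

/-- **The wild collar flap** `Φ (s, y) = (axial s y, fibre s y)`. [folklore] -/
def Φ (p : ℝ × ℝ) : ℝ × 𝔼 2 := (axial p.1 p.2, fibre p.1 p.2)

/-! ## Strict monotonicity of the smooth transition across the line -/

/-- **`χ` is strictly increasing across `(0, 1)`**: if `x < y`, `x < 1` and `0 < y` then
`χ x < χ y` (from `strictMonoOn_smoothTransition`, `PlanarArch.lean`, after clamping both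
points into `[0, 1]`). [folklore] -/
theorem χ_lt_of_lt {x y : ℝ} (hxy : x < y) (hx : x < 1) (hy : 0 < y) : χ x < χ y := by
  set x' := max x 0 with hx'
  set y' := min y 1 with hy'
  have hxx' : χ x = χ x' := by
    rcases le_or_gt x 0 with h | h
    · rw [hx', max_eq_right h, Real.smoothTransition.zero_of_nonpos h, Real.smoothTransition.zero]
    · rw [hx', max_eq_left h.le]
  have hyy' : χ y = χ y' := by
    rcases le_or_gt 1 y with h | h
    · rw [hy', min_eq_right h, Real.smoothTransition.one_of_one_le h, Real.smoothTransition.one]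
    · rw [hy', min_eq_left h.le]
  rw [hxx', hyy']
  have hlt : x' < y' := by
    rw [hx', hy', max_lt_iff, lt_min_iff, lt_min_iff]
    exact ⟨⟨hxy, hx⟩, ⟨hy, one_pos⟩⟩
  exact strictMonoOn_smoothTransition ⟨le_max_right _ _, hlt.le.trans (min_le_right _ _)⟩
    ⟨(le_max_right _ _).trans hlt.le, min_le_right _ _⟩ hlt

/-- `χ x = χ y` with `x < y` forces both points onto one flat piece. [folklore] -/
theorem χ_eq_imp {x y : ℝ} (hxy : x < y) (h : χ x = χ y) : y ≤ 0 ∨ 1 ≤ x := by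
  by_contra hcon
  simp only [not_or, not_le] at hcon
  exact (χ_lt_of_lt hxy hcon.2 hcon.1).ne h

/-! ## Planar vectors -/

/-- Coordinates of `vec a b`: the first is `a`. [folklore] -/
@[simp] theorem vec_apply_zero (a b : ℝ) : vec a b 0 = a := by
  simp [vec, e₀, e₁]

/-- Coordinates of `vec a b`: the second is `b`. [folklore] -/
@[simp] theorem vec_apply_one (a b : ℝ) : vec a b 1 = b := by
  simp [vec, e₀, e₁]

/-- `vec` is injective in both coordinates. [folklore] -/
theorem vec_eq_vec_iff {a b a' b' : ℝ} : vec a b = vec a' b' ↔ a = a' ∧ b = b' := by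
  constructor
  · intro h
    exact ⟨by simpa using congrArg (fun v : 𝔼 2 ↦ v 0) h,
      by simpa using congrArg (fun v : 𝔼 2 ↦ v 1) h⟩
  · rintro ⟨rfl, rfl⟩; rfl

/-- The norm of `vec a b` is `√(a² + b²)`. [folklore] -/
theorem norm_vec (a b : ℝ) : ‖vec a b‖ = Real.sqrt (a ^ 2 + b ^ 2) := by
  rw [EuclideanSpace.norm_eq, Fin.sum_univ_two, vec_apply_zero, vec_apply_one]
  simp [sq_abs]

/-- `vec a b = 0` iff `a = b = 0`. [folklore] -/
theorem vec_eq_zero_iff {a b : ℝ} : vec a b = 0 ↔ a = 0 ∧ b = 0 := by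
  have : (0 : 𝔼 2) = vec 0 0 := by simp [vec]
  rw [this, vec_eq_vec_iff]

/-- A polar vector `r (cos t, sin t)` has norm `|r|`. [folklore] -/
theorem norm_vec_polar (r t : ℝ) : ‖vec (r * Real.cos t) (r * Real.sin t)‖ = |r| := by
  rw [norm_vec]
  have : (r * Real.cos t) ^ 2 + (r * Real.sin t) ^ 2 = r ^ 2 := by
    nlinarith [Real.sin_sq_add_cos_sq t]
  rw [this, Real.sqrt_sq_eq_abs]

/-- **Polar vectors with the same positive radius and the same point of the circle have angles
differing by a multiple of `2π`.** [folklore] -/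
theorem exists_int_of_vec_polar_eq {r t t' : ℝ} (hr : r ≠ 0)
    (h : vec (r * Real.cos t) (r * Real.sin t) = vec (r * Real.cos t') (r * Real.sin t')) :
    ∃ k : ℤ, t' = t + k * (2 * π) := by
  rw [vec_eq_vec_iff] at h
  have hc : Real.cos t = Real.cos t' := mul_left_cancel₀ hr h.1
  have hs : Real.sin t = Real.sin t' := mul_left_cancel₀ hr h.2
  have hang : (t' : Real.Angle) = (t : Real.Angle) := (Real.Angle.cos_sin_inj hc hs).symm
  rw [Real.Angle.angle_eq_iff_two_pi_dvd_sub] at hang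
  obtain ⟨k, hk⟩ := hang
  exact ⟨k, by linarith⟩

/-- `vec` is smooth in its two real arguments. [folklore] -/
theorem contDiff_vec {f g : ℝ × ℝ → ℝ} (hf : ContDiff ℝ ∞ f) (hg : ContDiff ℝ ∞ g) :
    ContDiff ℝ ∞ fun p ↦ vec (f p) (g p) :=
  (hf.smul contDiff_const).add (hg.smul contDiff_const)

/-! ## Values of the profiles -/

section Values

/-! ### `Λ` -/

/-- `Λ_of_le`: a value / unfolding of the explicit construction (see the module docstring). [folklore] -/
theorem Λ_of_le {s : ℝ} (hs : s ≤ 1 / 200) : Λ s = 1 := by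
  have h1 : χ (200 * s - 1) = 0 := Real.smoothTransition.zero_of_nonpos (by linarith)
  have h2 : χ (100 * s - 4) = 0 := Real.smoothTransition.zero_of_nonpos (by linarith)
  simp [Λ, h1, h2]

/-- `Λ_of_mem`: a value / unfolding of the explicit construction (see the module docstring). [folklore] -/
theorem Λ_of_mem {s : ℝ} (hs : s ∈ Icc (1 / 100 : ℝ) (4 / 100)) : Λ s = 1 / 10 := by
  have h1 : χ (200 * s - 1) = 1 := Real.smoothTransition.one_of_one_le (by linarith [hs.1])
  have h2 : χ (100 * s - 4) = 0 := Real.smoothTransition.zero_of_nonpos (by linarith [hs.2])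
  simp only [Λ, h1, h2]; norm_num

/-- `Λ_of_ge`: a value / unfolding of the explicit construction (see the module docstring). [folklore] -/
theorem Λ_of_ge {s : ℝ} (hs : 5 / 100 ≤ s) : Λ s = 0 := by
  have h1 : χ (200 * s - 1) = 1 := Real.smoothTransition.one_of_one_le (by linarith)
  have h2 : χ (100 * s - 4) = 1 := Real.smoothTransition.one_of_one_le (by linarith)
  simp only [Λ, h1, h2]; norm_num

/-- `Λ_nonneg`: an elementary bound or non-vanishing for the explicit construction (see the module docstring). [folklore] -/
theorem Λ_nonneg (s : ℝ) : 0 ≤ Λ s := by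
  have h1 := Real.smoothTransition.le_one (200 * s - 1)
  have h2 := Real.smoothTransition.le_one (100 * s - 4)
  simp only [Λ]; linarith

/-- `Λ_le_one`: an elementary bound or non-vanishing for the explicit construction (see the module docstring). [folklore] -/
theorem Λ_le_one (s : ℝ) : Λ s ≤ 1 := by
  have h1 := Real.smoothTransition.nonneg (200 * s - 1)
  have h2 := Real.smoothTransition.nonneg (100 * s - 4)
  simp only [Λ]; linarith

/-- `Λ s ≥ 1/10` for `s ≤ 4/100`. [folklore] -/
theorem Λ_ge_tenth {s : ℝ} (hs : s ≤ 4 / 100) : 1 / 10 ≤ Λ s := by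
  have h1 := Real.smoothTransition.le_one (200 * s - 1)
  have h2 : χ (100 * s - 4) = 0 := Real.smoothTransition.zero_of_nonpos (by linarith)
  simp only [Λ, h2]; linarith

/-- `Λ s ≤ 1/10` for `1/100 ≤ s`. [folklore] -/
theorem Λ_le_tenth {s : ℝ} (hs : 1 / 100 ≤ s) : Λ s ≤ 1 / 10 := by
  have h1 : χ (200 * s - 1) = 1 := Real.smoothTransition.one_of_one_le (by linarith)
  have h2 := Real.smoothTransition.nonneg (100 * s - 4)
  simp only [Λ, h1]; linarith

/-- `Λ s > 0` for `s < 5/100`. [folklore] -/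
theorem Λ_pos {s : ℝ} (hs : s < 5 / 100) : 0 < Λ s := by
  have h1 := Real.smoothTransition.le_one (200 * s - 1)
  have h2 : χ (100 * s - 4) < 1 := Real.smoothTransition.lt_one_of_lt_one (by linarith)
  simp only [Λ]; linarith

/-! ### `ψ` -/

/-- `sin_ψ₀`: an elementary property of the explicit construction (see the module docstring). [folklore] -/
theorem sin_ψ₀ : Real.sin ψ₀ = 1 / 5 := by
  rw [ψ₀, Real.sin_arcsin] <;> norm_num

/-- `ψ₀_pos`: an elementary bound or non-vanishing for the explicit construction (see the module docstring). [folklore] -/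
theorem ψ₀_pos : 0 < ψ₀ := by
  rw [ψ₀]; exact Real.arcsin_pos.2 (by norm_num)

/-- `ψ₀_lt_pi_div_two`: an elementary bound or non-vanishing for the explicit construction (see the module docstring). [folklore] -/
theorem ψ₀_lt_pi_div_two : ψ₀ < π / 2 := by
  rw [ψ₀]; exact Real.arcsin_lt_pi_div_two.2 (by norm_num)

/-- `ψ_of_le`: a value / unfolding of the explicit construction (see the module docstring). [folklore] -/
theorem ψ_of_le {s : ℝ} (hs : s ≤ 1 / 100) : ψ s = 0 := by
  have h1 : χ (200 * s - 2) = 0 := Real.smoothTransition.zero_of_nonpos (by linarith)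
  have h2 : χ (100 * s - 3) = 0 := Real.smoothTransition.zero_of_nonpos (by linarith)
  simp [ψ, h1, h2]

/-- `ψ_of_mem`: a value / unfolding of the explicit construction (see the module docstring). [folklore] -/
theorem ψ_of_mem {s : ℝ} (hs : s ∈ Icc (3 / 200 : ℝ) (3 / 100)) : ψ s = ψ₀ := by
  have h1 : χ (200 * s - 2) = 1 := Real.smoothTransition.one_of_one_le (by linarith [hs.1])
  have h2 : χ (100 * s - 3) = 0 := Real.smoothTransition.zero_of_nonpos (by linarith [hs.2])
  simp [ψ, h1, h2]

/-- `ψ_of_ge`: a value / unfolding of the explicit construction (see the module docstring). [folklore] -/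
theorem ψ_of_ge {s : ℝ} (hs : 4 / 100 ≤ s) : ψ s = π / 2 := by
  have h1 : χ (200 * s - 2) = 1 := Real.smoothTransition.one_of_one_le (by linarith)
  have h2 : χ (100 * s - 3) = 1 := Real.smoothTransition.one_of_one_le (by linarith)
  simp only [ψ, h1, h2]; ring

/-- `ψ_nonneg`: an elementary bound or non-vanishing for the explicit construction (see the module docstring). [folklore] -/
theorem ψ_nonneg (s : ℝ) : 0 ≤ ψ s := by
  have h1 := Real.smoothTransition.nonneg (200 * s - 2)
  have h2 := Real.smoothTransition.nonneg (100 * s - 3)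
  have := ψ₀_pos; have := ψ₀_lt_pi_div_two
  simp only [ψ]; positivity

/-- `ψ_le_pi_div_two`: an elementary bound or non-vanishing for the explicit construction (see the module docstring). [folklore] -/
theorem ψ_le_pi_div_two (s : ℝ) : ψ s ≤ π / 2 := by
  have h1 := Real.smoothTransition.le_one (200 * s - 2)
  have h2 := Real.smoothTransition.le_one (100 * s - 3)
  have := ψ₀_pos; have := ψ₀_lt_pi_div_two
  simp only [ψ]; nlinarith

/-- `ψ s ≤ ψ₀` for `s ≤ 3/100`. [folklore] -/
theorem ψ_le_ψ₀ {s : ℝ} (hs : s ≤ 3 / 100) : ψ s ≤ ψ₀ := by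
  have h1 := Real.smoothTransition.le_one (200 * s - 2)
  have h2 : χ (100 * s - 3) = 0 := Real.smoothTransition.zero_of_nonpos (by linarith)
  have := ψ₀_pos
  simp only [ψ, h2]; nlinarith

/-- `ψ s > 0` for `1/100 < s`. [folklore] -/
theorem ψ_pos {s : ℝ} (hs : 1 / 100 < s) : 0 < ψ s := by
  have h1 : 0 < χ (200 * s - 2) := Real.smoothTransition.pos_of_pos (by linarith)
  have h2 := Real.smoothTransition.nonneg (100 * s - 3)
  have := ψ₀_pos; have := ψ₀_lt_pi_div_two
  simp only [ψ]; nlinarith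

/-- `sin_ψ_nonneg`: an elementary bound or non-vanishing for the explicit construction (see the module docstring). [folklore] -/
theorem sin_ψ_nonneg (s : ℝ) : 0 ≤ Real.sin (ψ s) :=
  Real.sin_nonneg_of_nonneg_of_le_pi (ψ_nonneg s) (by linarith [ψ_le_pi_div_two s, pi_pos])

/-- `sin_ψ_le_one`: an elementary bound or non-vanishing for the explicit construction (see the module docstring). [folklore] -/
theorem sin_ψ_le_one (s : ℝ) : Real.sin (ψ s) ≤ 1 := Real.sin_le_one _

/-- `sin (ψ s) ≤ 1/5` for `s ≤ 3/100`. [folklore] -/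
theorem sin_ψ_le_fifth {s : ℝ} (hs : s ≤ 3 / 100) : Real.sin (ψ s) ≤ 1 / 5 := by
  rw [← sin_ψ₀]
  exact Real.sin_le_sin_of_le_of_le_pi_div_two (by linarith [ψ_nonneg s, pi_pos])
    ψ₀_lt_pi_div_two.le (ψ_le_ψ₀ hs)

/-- `sin (ψ s) > 0` for `1/100 < s`. [folklore] -/
theorem sin_ψ_pos {s : ℝ} (hs : 1 / 100 < s) : 0 < Real.sin (ψ s) :=
  Real.sin_pos_of_pos_of_lt_pi (ψ_pos hs) (by linarith [ψ_le_pi_div_two s, pi_pos])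

/-- `sin_ψ_of_le`: a value / unfolding of the explicit construction (see the module docstring). [folklore] -/
theorem sin_ψ_of_le {s : ℝ} (hs : s ≤ 1 / 100) : Real.sin (ψ s) = 0 := by
  rw [ψ_of_le hs, Real.sin_zero]

/-- `sin_ψ_of_ge`: a value / unfolding of the explicit construction (see the module docstring). [folklore] -/
theorem sin_ψ_of_ge {s : ℝ} (hs : 4 / 100 ≤ s) : Real.sin (ψ s) = 1 := by
  rw [ψ_of_ge hs, Real.sin_pi_div_two]

/-! ### `θh` -/

/-- `θh_of_le`: a value / unfolding of the explicit construction (see the module docstring). [folklore] -/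
theorem θh_of_le {s : ℝ} (hs : s ≤ 2 / 100) : θh s = 0 := by
  have h1 : χ (100 * s - 2) = 0 := Real.smoothTransition.zero_of_nonpos (by linarith)
  simp [θh, h1]

/-- `θh_of_ge`: a value / unfolding of the explicit construction (see the module docstring). [folklore] -/
theorem θh_of_ge {s : ℝ} (hs : 3 / 100 ≤ s) : θh s = 1 / 2 := by
  have h1 : χ (100 * s - 2) = 1 := Real.smoothTransition.one_of_one_le (by linarith)
  simp [θh, h1]

/-- `θh_nonneg`: an elementary bound or non-vanishing for the explicit construction (see the module docstring). [folklore] -/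
theorem θh_nonneg (s : ℝ) : 0 ≤ θh s := by
  have := Real.smoothTransition.nonneg (100 * s - 2); simp only [θh]; positivity

/-- `θh_le_half`: an elementary bound or non-vanishing for the explicit construction (see the module docstring). [folklore] -/
theorem θh_le_half (s : ℝ) : θh s ≤ 1 / 2 := by
  have := Real.smoothTransition.le_one (100 * s - 2); simp only [θh]; linarith

/-- `θh_mono`: an elementary property of the explicit construction (see the module docstring). [folklore] -/
theorem θh_mono : Monotone θh := fun s t hst ↦ by
  simp only [θh]
  have := Real.smoothTransition.monotone (show 100 * s - 2 ≤ 100 * t - 2 by linarith)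
  linarith

/-- `θh` is strictly increasing across `[2/100, 3/100]`. [folklore] -/
theorem θh_lt_θh {s t : ℝ} (hst : s < t) (hs : s < 3 / 100) (ht : 2 / 100 < t) :
    θh s < θh t := by
  simp only [θh]
  have := χ_lt_of_lt (show 100 * s - 2 < 100 * t - 2 by linarith)
    (by linarith) (by linarith)
  linarith

/-! ### `crad` -/

/-- `crad_of_le`: a value / unfolding of the explicit construction (see the module docstring). [folklore] -/
theorem crad_of_le {s : ℝ} (hs : s ≤ 2 / 100) : crad s = 3 / 100 + s := by
  have h1 : χ (100 * s - 2) = 0 := Real.smoothTransition.zero_of_nonpos (by linarith)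
  simp [crad, h1]

/-- `crad_of_ge`: a value / unfolding of the explicit construction (see the module docstring). [folklore] -/
theorem crad_of_ge {s : ℝ} (hs : 3 / 100 ≤ s) : crad s = 7 / 100 - s := by
  have h1 : χ (100 * s - 2) = 1 := Real.smoothTransition.one_of_one_le (by linarith)
  simp only [crad, h1]; ring

/-- The bump form of the radius. [folklore] -/
theorem crad_eq (s : ℝ) : crad s = 5 / 100 + (s - 2 / 100) * (1 - 2 * χ (100 * s - 2)) := by
  simp only [crad]; ring

/-- On `[2/100, ∞)` the radius is at least `5/100` exactly when `χ (100 s - 2) ≤ 1/2`.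
[folklore] -/
theorem crad_ge_iff {s : ℝ} (hs : 2 / 100 < s) : 5 / 100 ≤ crad s ↔ χ (100 * s - 2) ≤ 1 / 2 := by
  rw [crad_eq]
  constructor
  · intro h; nlinarith
  · intro h; nlinarith

/-- `crad_lt_iff`: an elementary bound or non-vanishing for the explicit construction (see the module docstring). [folklore] -/
theorem crad_lt_iff {s : ℝ} (hs : 2 / 100 < s) : crad s < 5 / 100 ↔ 1 / 2 < χ (100 * s - 2) := by
  rw [← not_le, crad_ge_iff hs, not_le]

/-- Upper bound `crad s ≤ 6/100`. [folklore] -/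
theorem crad_le (s : ℝ) : crad s ≤ 6 / 100 := by
  rcases le_or_gt s (2 / 100) with h | h
  · rw [crad_of_le h]; linarith
  rcases le_or_gt (3 / 100) s with h' | h'
  · rw [crad_of_ge h']; linarith
  · rw [crad_eq]
    have h1 := Real.smoothTransition.nonneg (100 * s - 2)
    have h2 := Real.smoothTransition.le_one (100 * s - 2)
    nlinarith

/-- On `(-3/100, 2/100]` the radius `3/100 + s` is positive. [folklore] -/
theorem crad_pos_of_mem {s : ℝ} (hs : s ∈ Ioc (-(3 / 100) : ℝ) (2 / 100)) : 0 < crad s := by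
  rw [crad_of_le hs.2]; linarith [hs.1]

/-! ### `σ`, `υ`, `ystar` -/

/-- `σ_pos`: an elementary bound or non-vanishing for the explicit construction (see the module docstring). [folklore] -/
theorem σ_pos {y : ℝ} (hy : -(11 / 10) < y) : 0 < σ y := by simp only [σ]; linarith

/-- `σ_lt_one`: an elementary bound or non-vanishing for the explicit construction (see the module docstring). [folklore] -/
theorem σ_lt_one {y : ℝ} (hy : y < 1 / 10) : σ y < 1 := by simp only [σ]; linarith

/-- `σ_strictMono`: an elementary property of the explicit construction (see the module docstring). [folklore] -/
theorem σ_strictMono : StrictMono σ := fun y y' h ↦ by simp only [σ]; linarith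

/-- `σ_injective`: an elementary property of the explicit construction (see the module docstring). [folklore] -/
theorem σ_injective : Function.Injective σ := σ_strictMono.injective

/-- `two_pi_add_one_pos`: an elementary bound or non-vanishing for the explicit construction (see the module docstring). [folklore] -/
theorem two_pi_add_one_pos : 0 < 2 * π + 1 := by positivity

/-- `σ_ystar`: an elementary property of the explicit construction (see the module docstring). [folklore] -/
theorem σ_ystar : σ ystar = 1 / (2 * π + 1) := by
  have := two_pi_add_one_pos
  simp only [σ, ystar]; field_simp; ring

/-- `ystar_gt`: an elementary bound or non-vanishing for the explicit construction (see the module docstring). [folklore] -/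
theorem ystar_gt : -(11 / 10) < ystar := by
  have := two_pi_add_one_pos
  simp only [ystar]
  have : 0 < 6 / 5 / (2 * π + 1) := by positivity
  linarith

/-- `ystar_lt`: an elementary bound or non-vanishing for the explicit construction (see the module docstring). [folklore] -/
theorem ystar_lt : ystar < 1 / 10 := by
  simp only [ystar]
  have h3 : (3 : ℝ) < π := Real.pi_gt_three
  have : 6 / 5 / (2 * π + 1) < 12 / 10 := by
    rw [div_lt_iff₀ two_pi_add_one_pos]; nlinarith
  linarith

/-- `υ_nonneg`: an elementary bound or non-vanishing for the explicit construction (see the module docstring). [folklore] -/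
theorem υ_nonneg (y : ℝ) : 0 ≤ υ y := Real.smoothTransition.nonneg _

/-- `υ_le_one`: an elementary bound or non-vanishing for the explicit construction (see the module docstring). [folklore] -/
theorem υ_le_one (y : ℝ) : υ y ≤ 1 := Real.smoothTransition.le_one _

/-- `υ_of_ge`: a value / unfolding of the explicit construction (see the module docstring). [folklore] -/
theorem υ_of_ge {y : ℝ} (hy : ystar ≤ y) : υ y = 1 :=
  Real.smoothTransition.one_of_one_le (by linarith)

/-- `υ_lt_one`: an elementary bound or non-vanishing for the explicit construction (see the module docstring). [folklore] -/
theorem υ_lt_one {y : ℝ} (hy : y < ystar) : υ y < 1 :=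
  Real.smoothTransition.lt_one_of_lt_one (by linarith)

/-- `υ_mono`: an elementary property of the explicit construction (see the module docstring). [folklore] -/
theorem υ_mono : Monotone υ := fun y y' h ↦
  Real.smoothTransition.monotone (by linarith)

/-! ### `ang` -/

/-- `ang_of_le`: a value / unfolding of the explicit construction (see the module docstring). [folklore] -/
theorem ang_of_le {s : ℝ} (hs : s ≤ 1 / 100) (y : ℝ) : ang s y = 0 := by
  simp [ang, sin_ψ_of_le hs]

/-- `ang_nonneg`: an elementary bound or non-vanishing for the explicit construction (see the module docstring). [folklore] -/
theorem ang_nonneg (s : ℝ) {y : ℝ} (hy : -(11 / 10) < y) : 0 ≤ ang s y := by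
  have := sin_ψ_nonneg s; have := σ_pos hy; have := two_pi_add_one_pos
  simp only [ang]; positivity

/-- `(2π + 1)/5 < π/2` (i.e. `2 < π`): the lift-off directions stay in the open quarter plane.
[folklore] -/
theorem two_pi_add_one_div_five_lt : (2 * π + 1) / 5 < π / 2 := by
  have h3 : (3 : ℝ) < π := Real.pi_gt_three
  linarith

/-- For `s ≤ 3/100` the direction angle is `< π/2`. [folklore] -/
theorem ang_lt_pi_div_two {s : ℝ} (hs : s ≤ 3 / 100) {y : ℝ} (hy₁ : -(11 / 10) < y)
    (hy₂ : y < 1 / 10) : ang s y < π / 2 := by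
  have h1 := sin_ψ_le_fifth hs
  have h2 := sin_ψ_nonneg s
  have h3 := σ_lt_one hy₂
  have h4 := σ_pos hy₁
  have h5 := two_pi_add_one_pos
  have h6 := two_pi_add_one_div_five_lt
  calc ang s y = Real.sin (ψ s) * (2 * π + 1) * σ y := rfl
    _ ≤ 1 / 5 * (2 * π + 1) * 1 := by
        apply mul_le_mul (mul_le_mul_of_nonneg_right h1 h5.le) h3.le h4.le
        positivity
    _ < π / 2 := by linarith

/-- The direction angle is always `< 2π + 1`. [folklore] -/
theorem ang_lt (s : ℝ) {y : ℝ} (hy₁ : -(11 / 10) < y) (hy₂ : y < 1 / 10) :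
    ang s y < 2 * π + 1 := by
  have h1 := sin_ψ_le_one s
  have h2 := sin_ψ_nonneg s
  have h3 := σ_lt_one hy₂
  have h4 := σ_pos hy₁
  have h5 := two_pi_add_one_pos
  calc ang s y = Real.sin (ψ s) * (2 * π + 1) * σ y := rfl
    _ < 1 * (2 * π + 1) * 1 := by
        apply mul_lt_mul' (mul_le_mul_of_nonneg_right h1 h5.le) h3 h4.le
        positivity
    _ = 2 * π + 1 := by ring

/-- For `s ≥ 4/100` the direction angle is `(2π + 1) σ y`. [folklore] -/
theorem ang_of_ge {s : ℝ} (hs : 4 / 100 ≤ s) (y : ℝ) : ang s y = (2 * π + 1) * σ y := by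
  simp [ang, sin_ψ_of_ge hs]

/-! ### `axial` -/

/-- On the attaching zone `s ≤ 1/200` the axial coordinate is `y`. [folklore] -/
theorem axial_of_le {s : ℝ} (hs : s ≤ 1 / 200) (y : ℝ) : axial s y = y := by
  have h1 : θh s = 0 := θh_of_le (by linarith)
  have h2 : Real.sin (ψ s) = 0 := sin_ψ_of_le (by linarith)
  simp [axial, Λ_of_le hs, h1, h2]

/-- On era `A` (`s ≤ 1/100`) the axial coordinate is `Λ s · y`. [folklore] -/
theorem axial_of_le' {s : ℝ} (hs : s ≤ 1 / 100) (y : ℝ) : axial s y = Λ s * y := by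
  have h1 : θh s = 0 := θh_of_le (by linarith)
  simp [axial, h1, sin_ψ_of_le hs]

/-- Upper bound on the axial coordinate: `axial s y ≤ θh s + 1/100 + 1/10` for `1/100 ≤ s` and
`y < 1/10`. [folklore] -/
theorem axial_le {s y : ℝ} (hs : 1 / 100 ≤ s) (hy : y < 1 / 10) :
    axial s y ≤ θh s + 11 / 100 := by
  have h1 := Λ_le_tenth hs
  have h2 := Λ_nonneg s
  have h3 := sin_ψ_le_one s
  have h4 := sin_ψ_nonneg s
  have h5 := υ_le_one y
  have h6 := υ_nonneg y
  simp only [axial]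
  nlinarith

/-- Lower bound on the axial coordinate: `θh s - 11/100 ≤ axial s y` for `1/100 ≤ s` and
`-11/10 < y`. [folklore] -/
theorem axial_ge {s y : ℝ} (hs : 1 / 100 ≤ s) (hy : -(11 / 10) < y) :
    θh s - 11 / 100 ≤ axial s y := by
  have h1 := Λ_le_tenth hs
  have h2 := Λ_nonneg s
  have h4 := sin_ψ_nonneg s
  have h6 := υ_nonneg y
  simp only [axial]
  nlinarith

/-- Global bounds: `-11/10 < axial s y < 7/10` on `(-∞, 7/100) × (-11/10, 1/10)`. [folklore] -/
theorem axial_mem {s y : ℝ} (hy₁ : -(11 / 10) < y) (hy₂ : y < 1 / 10) :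
    axial s y ∈ Ioo (-(11 / 10) : ℝ) (7 / 10) := by
  have h0 := Λ_nonneg s
  have h0' := Λ_le_one s
  have h1 := θh_nonneg s
  have h2 := θh_le_half s
  have h3 := sin_ψ_le_one s
  have h4 := sin_ψ_nonneg s
  have h5 := υ_le_one y
  have h6 := υ_nonneg y
  simp only [axial, mem_Ioo]
  constructor <;> nlinarith

/-! ### `fibre` -/

/-- The norm of the fibre coordinate is the radius. [folklore] -/
theorem norm_fibre (s y : ℝ) : ‖fibre s y‖ = |crad s| := norm_vec_polar _ _

/-- On era `A` and before (`s ≤ 1/100`) the fibre coordinate is `(3/100 + s, 0)`. [folklore] -/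
theorem fibre_of_le {s : ℝ} (hs : s ≤ 1 / 100) (y : ℝ) : fibre s y = vec (3 / 100 + s) 0 := by
  simp [fibre, ang_of_le hs, crad_of_le (by linarith : s ≤ 2 / 100)]

/-- The fibre coordinate vanishes only where the radius does. [folklore] -/
theorem fibre_ne_zero {s : ℝ} (hs : crad s ≠ 0) (y : ℝ) : fibre s y ≠ 0 := by
  rw [← norm_ne_zero_iff, norm_fibre]; exact abs_ne_zero.2 hs

/-- First coordinate of the fibre. [folklore] -/
@[simp] theorem fibre_apply_zero (s y : ℝ) : fibre s y 0 = crad s * Real.cos (ang s y) :=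
  vec_apply_zero _ _

/-- Second coordinate of the fibre. [folklore] -/
@[simp] theorem fibre_apply_one (s y : ℝ) : fibre s y 1 = crad s * Real.sin (ang s y) :=
  vec_apply_one _ _

/-! ### `Φ` -/

/-- Components of `Φ`. [folklore] -/
@[simp] theorem Φ_fst (p : ℝ × ℝ) : (Φ p).1 = axial p.1 p.2 := rfl

/-- Components of `Φ`. [folklore] -/
@[simp] theorem Φ_snd (p : ℝ × ℝ) : (Φ p).2 = fibre p.1 p.2 := rfl

/-- **On the attaching zone the flap is the flat strip**: `Φ (s, y) = (y, (3/100 + s, 0))` for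
`s ≤ 1/200`. [folklore] -/
theorem Φ_of_le {s : ℝ} (hs : s ≤ 1 / 200) (y : ℝ) : Φ (s, y) = (y, vec (3 / 100 + s) 0) := by
  rw [Φ, axial_of_le hs, fibre_of_le (by linarith)]

end Values

/-! ## Smoothness -/

section Smooth

/-- `s ↦ χ (a s - b)` is smooth. [folklore] -/
theorem contDiff_χ_affine (a b : ℝ) : ContDiff ℝ ∞ fun s : ℝ ↦ χ (a * s - b) :=
  Real.smoothTransition.contDiff.comp ((contDiff_const.mul contDiff_id).sub contDiff_const)

/-- `contDiff_Λ`: smoothness / differentiability of the explicit profile or map (see the module docstring). [folklore] -/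
theorem contDiff_Λ : ContDiff ℝ ∞ Λ := by
  unfold Λ
  exact (contDiff_const.sub (contDiff_const.mul (contDiff_χ_affine 200 1))).sub
    (contDiff_const.mul (contDiff_χ_affine 100 4))

/-- `contDiff_ψ`: smoothness / differentiability of the explicit profile or map (see the module docstring). [folklore] -/
theorem contDiff_ψ : ContDiff ℝ ∞ ψ := by
  unfold ψ
  exact (contDiff_const.mul (contDiff_χ_affine 200 2)).add
    (contDiff_const.mul (contDiff_χ_affine 100 3))

/-- `contDiff_θh`: smoothness / differentiability of the explicit profile or map (see the module docstring). [folklore] -/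
theorem contDiff_θh : ContDiff ℝ ∞ θh := by
  unfold θh
  exact contDiff_const.mul (contDiff_χ_affine 100 2)

/-- `contDiff_crad`: smoothness / differentiability of the explicit profile or map (see the module docstring). [folklore] -/
theorem contDiff_crad : ContDiff ℝ ∞ crad := by
  unfold crad
  exact (contDiff_const.add contDiff_id).sub
    ((contDiff_const.mul (contDiff_id.sub contDiff_const)).mul (contDiff_χ_affine 100 2))

/-- `contDiff_σ`: smoothness / differentiability of the explicit profile or map (see the module docstring). [folklore] -/
theorem contDiff_σ : ContDiff ℝ ∞ σ := by
  unfold σ; exact contDiff_const.mul (contDiff_id.add contDiff_const)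

/-- `contDiff_υ`: smoothness / differentiability of the explicit profile or map (see the module docstring). [folklore] -/
theorem contDiff_υ : ContDiff ℝ ∞ υ := by
  unfold υ
  exact Real.smoothTransition.contDiff.comp ((contDiff_const.add contDiff_id).sub contDiff_const)

/-- `contDiff_ang`: smoothness / differentiability of the explicit profile or map (see the module docstring). [folklore] -/
theorem contDiff_ang : ContDiff ℝ ∞ fun p : ℝ × ℝ ↦ ang p.1 p.2 := by
  unfold ang
  exact ((Real.contDiff_sin.comp (contDiff_ψ.comp contDiff_fst)).mul contDiff_const).mul
    (contDiff_σ.comp contDiff_snd)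

/-- `contDiff_axial`: smoothness / differentiability of the explicit profile or map (see the module docstring). [folklore] -/
theorem contDiff_axial : ContDiff ℝ ∞ fun p : ℝ × ℝ ↦ axial p.1 p.2 := by
  unfold axial
  exact ((contDiff_θh.comp contDiff_fst).add ((contDiff_Λ.comp contDiff_fst).mul contDiff_snd)).add
    ((contDiff_const.mul (Real.contDiff_sin.comp (contDiff_ψ.comp contDiff_fst))).mul
      (contDiff_υ.comp contDiff_snd))

/-- `contDiff_fibre`: smoothness / differentiability of the explicit profile or map (see the module docstring). [folklore] -/
theorem contDiff_fibre : ContDiff ℝ ∞ fun p : ℝ × ℝ ↦ fibre p.1 p.2 := by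
  unfold fibre
  exact contDiff_vec ((contDiff_crad.comp contDiff_fst).mul (Real.contDiff_cos.comp contDiff_ang))
    ((contDiff_crad.comp contDiff_fst).mul (Real.contDiff_sin.comp contDiff_ang))

/-- **The flap map is `C^∞`.** [folklore] -/
theorem contDiff_Φ : ContDiff ℝ ∞ Φ := contDiff_axial.prodMk contDiff_fibre

/-- Slices in `s` are smooth. [folklore] -/
theorem contDiff_Φ_slice_fst (y : ℝ) : ContDiff ℝ ∞ fun s ↦ Φ (s, y) :=
  contDiff_Φ.comp (contDiff_id.prodMk contDiff_const)

/-- Slices in `y` are smooth. [folklore] -/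
theorem contDiff_Φ_slice_snd (s : ℝ) : ContDiff ℝ ∞ fun y ↦ Φ (s, y) :=
  contDiff_Φ.comp (contDiff_const.prodMk contDiff_id)

end Smooth

end WildFlap

end Literature.Topology.FourManifolds
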